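import Summits.QuantumFields.BalabanUV.Beta.D1BFx.GhostVertexOrientation
import Summits.QuantumFields.BalabanUV.Beta.D1BFx.OrientedProfileWords
import Summits.QuantumFields.BalabanUV.Beta.D1BFx.GhostVertexDensities

/-!
# `BalabanUV.Beta.D1BFx.GhostRoadWordLetters` — road «BF-x» for binder row D1, slot (K), GHOST-N8-SPEC v0.2 §3″ FILE F5 PART 1 «ROAD WORD LETTERS»:
# **A TWO-LEG BUBBLE AND A TADPOLE AT THE ROAD's GHOST VERTEX ∕ PAIR TABLE, FROM DISPLAYED LEG PROFILES ONLY** — F1 (orientation) ∘ F4 (densities) ∘ F2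
# (oriented profile words): the (5.10) decay of `z ↦ biBubble L₁ (𝒱 μ 0) L₂ (𝒱 ν z)` and of `z ↦ tadpole L (𝒲 μ 0 ν z)` with n-FREE coarse rates,
# for `𝒱 = n²•vertexRedF n ghCur`, `𝒲 = n²•tableRedF n (diag gh₂)` (the families of `RestKernelGhostUnitRow.abs_secondMoment_ghostWordK_le_unit`)

HONEST DEPENDENCY (cell records, verbatim): «continuum YM on T⁴ ⇐ BetaPertH ∧ nine spine estimates (0/9 proved); BetaPertH ⇐ (D1) ∧ (D4) ∧
CAP+tail; G-an2-4 gates asym, D1 and NE2/3/4.»  HONEST FRAMING (cell contract, verbatim): «discharging `BetaPertH` makes Bałaban's UV stability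
UNCONDITIONAL — a real constructive-QFT result; it is NOT the continuum limit and NOT the Clay problem.»  THIS MODULE DISCHARGES NOTHING of the
wall: [folklore] composition BY NAME of this seat's F1 `GhostVertexOrientation` (`smul_vertexRedF_ghCur_eq_gW`, `abs_comp_gW_le`), F4 `GhostVertexDensities`
(`abs_ghostWeight_le`, `abs_ghostWeight_sub_le`, `abs_ghostTable_le`, `ghostTable_eq_zero_of_far`) and F2 `OrientedProfileWords` (`decay510_biBubble_of_twoTerm`,
`decay510_tadpole_of_sup_range`); the legs `L₁ L₂ L` are ARBITRARY with DISPLAYED profile letters.  No definition, no `def … : Prop`, nothing cited, 0 sorry.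
0 root-level binders of row D1 discharged (hW ∕ hR-sockets ∕ hSX-socket ∕ D1Tel ∕ D1Rep = 0); (K) NOT closed; NOT D1, NOT `BetaPertH`, NOT continuum, NOT Clay.

ABSOLUTE RULE (cell charter, verbatim): «No internally-minted statement may enter as a cited fact. Every hypothesis is either kernel-proved in
this package or a verbatim quotation of a PUBLISHED theorem with page reference. The manuscript(s) under audit are NOT citable for their own
disputed steps — they are the thing under adjudication; programme-internal (2001/route/tribunal) claims are never citable.»

WHY (GHOST-N8-SPEC v0.2 §3″ (O8) F5; journal N-1 [D1LEAF04-G26-N1]).  Ten of the twelve ghost rest words are `±½·biBubble L₁ (𝒱 μ 0) L₂ (𝒱 ν z)` and two are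
`½·tadpole L (𝒲 μ 0 ν z)` (`RestKernelGhostWords.ghostWord`); PART 2 plugs the leg table (F3) word by word and books `n⁻⁸`.  This PART 1 is the leg-free
half: ONE lemma for all bubbles (four exponent sums `≤ 3`), ONE for both tadpoles.

CONTENT ([folklore]; `n = m + 1`; `κ₄ := kappa163 4`, `σ := κ₄∕16`; `K₅`, `K₆` = F4's constants; fibre `Unit`, `|Unit| = 1` kept symbolic).
* §1 **`decay510_road_biBubble`**: legs with value ∕ right-difference profiles `(κ₁, a₁; κ₁′, a₁′)`, `(κ₂, a₂; κ₂′, a₂′)` at rate `δ∕n`, all four sums `≤ 3`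
  ⟹ `Decay510 (z ↦ biBubble L₁ (𝒱 μ 0) L₂ (𝒱 ν z)) (F2's four-term constant at K₁ = 4(1+2^{a₁′}e^δ)·(n²K₅)·κ₁′, K₂ = 4·2^{a₁}e^δ·(n²K₆e^{κ₄∕16})·κ₁, K₃, K₄ likewise)
  (min σ (2δ)∕2∕4)`.
* §2 **`decay510_road_tadpole`**: `|L x y| ≤ S` ⟹ `Decay510 (z ↦ tadpole L (𝒲 μ 0 ν z)) (S·3⁴·(n²·8K₅²e^{κ₄∕8})·K″(σ)·n⁴) (σ∕2∕4)`.
NOT HERE (honest): the leg table (F3), the twelve rows and the `n⁻⁸` bookkeeping (PART 2); anything of the END.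
Unit `b2b-balaban-beta-d1-formalise-leaf-04` (gen 26), D1 formalisation swarm, road «BF-x»; INTENT-6 [D1LEAF04-G26-INTENT-6]. Not in print; no existing file touched.
-/

noncomputable section

namespace Summit.QuantumFields.BalabanUV.Beta.D1BFx.GhostRoadWordLetters

open scoped BigOperators
open Finset
open Literature.MathematicalPhysics.QuantumFieldTheory.Balaban1983to89
open Literature.MathematicalPhysics.QuantumFieldTheory.Balaban1983to89.Beta
open B12Sec2to5 (l1 Decay510)
open ExpKernelCalculus (Site MKer comp tr tadpole)
open AffineAveraging (unitVec)
open KernelSpecInstance (wH)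
open B4TorusKernel (periodConst)
open B5Hk163Strip (kappa163 kappa163_pos)
open B5Hk163TorusHolderDecay (MD163)
open B5Hk163Decay (MG163)
open PoissonInterior (supNorm nrm nrm_pos)
open Summit.QuantumFields.BalabanUV.Beta.D1BFx.PackedKernelSplit (biBubble)
open Summit.QuantumFields.BalabanUV.Beta.D1BFx.GhostStencil (ghCur)
open Summit.QuantumFields.BalabanUV.Beta.D1BFx.TorusGhostPairStencils (gh₂)
open Summit.QuantumFields.BalabanUV.Beta.D1BFx.ReducedKernelF (vertexRedF)
open Summit.QuantumFields.BalabanUV.Beta.D1BFx.ReducedTableF (tableRedF)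
open Summit.QuantumFields.BalabanUV.Beta.D1BFx.GhostVertexOrientation (smul_vertexRedF_ghCur_eq_gW abs_comp_gW_le)
open Summit.QuantumFields.BalabanUV.Beta.D1BFx.GhostVertexDensities (abs_ghostWeight_le abs_ghostWeight_sub_le abs_ghostTable_le ghostTable_eq_zero_of_far)
open Summit.QuantumFields.BalabanUV.Beta.D1BFx.OrientedProfileWords (decay510_biBubble_of_twoTerm decay510_tadpole_of_sup_range)

/-! ## §1 The two-leg bubble at the road's ghost vertex -/

section Bubble

variable (m : ℕ) {L₁ L₂ : MKer 4 Unit} {κ₁ κ₁' κ₂ κ₂' δ : ℝ} {a₁ a₁' a₂ a₂' : ℕ}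
  (hκ₁ : 0 ≤ κ₁) (hκ₁' : 0 ≤ κ₁') (hκ₂ : 0 ≤ κ₂) (hκ₂' : 0 ≤ κ₂') (hδ : 0 < δ)
  (h11 : a₁' + a₂' ≤ 3) (h12 : a₁' + a₂ ≤ 3) (h21 : a₁ + a₂' ≤ 3) (h22 : a₁ + a₂ ≤ 3)
  (hL₁ : ∀ x y, |L₁ x y () ()| ≤ κ₁ / nrm (x - y) ^ a₁ * Real.exp (-(δ / ((m + 1 : ℕ) : ℝ)) * supNorm (x - y)))
  (hdL₁ : ∀ x y (μ : Fin 4), |L₁ x (y + unitVec μ) () () - L₁ x y () ()| ≤ κ₁' / nrm (x - y) ^ a₁' * Real.exp (-(δ / ((m + 1 : ℕ) : ℝ)) * supNorm (x - y)))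
  (hL₂ : ∀ x y, |L₂ x y () ()| ≤ κ₂ / nrm (x - y) ^ a₂ * Real.exp (-(δ / ((m + 1 : ℕ) : ℝ)) * supNorm (x - y)))
  (hdL₂ : ∀ x y (μ : Fin 4), |L₂ x (y + unitVec μ) () () - L₂ x y () ()| ≤ κ₂' / nrm (x - y) ^ a₂' * Real.exp (-(δ / ((m + 1 : ℕ) : ℝ)) * supNorm (x - y)))
include hκ₁ hκ₁' hκ₂ hκ₂' hδ h11 h12 h21 h22 hL₁ hdL₁ hL₂ hdL₂

/-- [folklore] **THE ROAD BUBBLE LETTER**: for any two legs with displayed value ∕ right-difference profiles whose four exponent sums are `≤ 3`, the bubble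
word at the road's ghost vertex families decays in the coarse displacement at the n-FREE rate `min (κ₄∕16) (2δ) ∕ 8`, with F2's four-term constant
read at F1's majorant constants and F4's densities (`A = n²·K₅`, `A′ = n²·K₆·e^{κ₄∕16}`). -/
theorem decay510_road_biBubble (μ ν : Fin 4) :
    Decay510 (fun z => biBubble L₁ ((fun κ u => (((m + 1 : ℕ) : ℝ) ^ 2) • vertexRedF (m + 1) (fun κ u => ghCur κ u) κ u) μ 0)
        L₂ ((fun κ u => (((m + 1 : ℕ) : ℝ) ^ 2) • vertexRedF (m + 1) (fun κ u => ghCur κ u) κ u) ν z))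
      ((Fintype.card Unit : ℝ) ^ 2 *
        (((4 * (1 + 2 ^ a₁' * Real.exp δ) * (|(((m + 1 : ℕ) : ℝ)) ^ 2| * ((((m + 1 : ℕ) : ℝ) ^ 5)⁻¹ * (MG163 4 * periodConst (kappa163 4) 3) * Real.exp (kappa163 4 / 4))) * κ₁')
            * (4 * (1 + 2 ^ a₂' * Real.exp δ) * (|(((m + 1 : ℕ) : ℝ)) ^ 2| * ((((m + 1 : ℕ) : ℝ) ^ 5)⁻¹ * (MG163 4 * periodConst (kappa163 4) 3) * Real.exp (kappa163 4 / 4))) * κ₂')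
            * (2 * (1 + 2 * (4 : ℕ) * 3 ^ ((4 : ℕ) - 1) * (((4 : ℕ) - 1 - (a₁' + a₂')).factorial * (8 / min (kappa163 4 / 16) (2 * δ)) ^ ((4 : ℕ) - 1 - (a₁' + a₂')) * (1 + 8 / min (kappa163 4 / 16) (2 * δ)))))
            * (((m + 1 : ℕ) : ℝ)) ^ (2 * 4 - (a₁' + a₂'))
          + (4 * (1 + 2 ^ a₁' * Real.exp δ) * (|(((m + 1 : ℕ) : ℝ)) ^ 2| * ((((m + 1 : ℕ) : ℝ) ^ 5)⁻¹ * (MG163 4 * periodConst (kappa163 4) 3) * Real.exp (kappa163 4 / 4))) * κ₁')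
            * (4 * 2 ^ a₂ * Real.exp δ * (|(((m + 1 : ℕ) : ℝ)) ^ 2| * ((((m + 1 : ℕ) : ℝ) ^ 6)⁻¹ * ((MD163 4 * periodConst (kappa163 4) 3) * Real.exp (kappa163 4 / 4)) * Real.exp (kappa163 4 / 16))) * κ₂)
            * (2 * (1 + 2 * (4 : ℕ) * 3 ^ ((4 : ℕ) - 1) * (((4 : ℕ) - 1 - (a₁' + a₂)).factorial * (8 / min (kappa163 4 / 16) (2 * δ)) ^ ((4 : ℕ) - 1 - (a₁' + a₂)) * (1 + 8 / min (kappa163 4 / 16) (2 * δ)))))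
            * (((m + 1 : ℕ) : ℝ)) ^ (2 * 4 - (a₁' + a₂))
          + (4 * 2 ^ a₁ * Real.exp δ * (|(((m + 1 : ℕ) : ℝ)) ^ 2| * ((((m + 1 : ℕ) : ℝ) ^ 6)⁻¹ * ((MD163 4 * periodConst (kappa163 4) 3) * Real.exp (kappa163 4 / 4)) * Real.exp (kappa163 4 / 16))) * κ₁)
            * (4 * (1 + 2 ^ a₂' * Real.exp δ) * (|(((m + 1 : ℕ) : ℝ)) ^ 2| * ((((m + 1 : ℕ) : ℝ) ^ 5)⁻¹ * (MG163 4 * periodConst (kappa163 4) 3) * Real.exp (kappa163 4 / 4))) * κ₂')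
            * (2 * (1 + 2 * (4 : ℕ) * 3 ^ ((4 : ℕ) - 1) * (((4 : ℕ) - 1 - (a₁ + a₂')).factorial * (8 / min (kappa163 4 / 16) (2 * δ)) ^ ((4 : ℕ) - 1 - (a₁ + a₂')) * (1 + 8 / min (kappa163 4 / 16) (2 * δ)))))
            * (((m + 1 : ℕ) : ℝ)) ^ (2 * 4 - (a₁ + a₂'))
          + (4 * 2 ^ a₁ * Real.exp δ * (|(((m + 1 : ℕ) : ℝ)) ^ 2| * ((((m + 1 : ℕ) : ℝ) ^ 6)⁻¹ * ((MD163 4 * periodConst (kappa163 4) 3) * Real.exp (kappa163 4 / 4)) * Real.exp (kappa163 4 / 16))) * κ₁)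
            * (4 * 2 ^ a₂ * Real.exp δ * (|(((m + 1 : ℕ) : ℝ)) ^ 2| * ((((m + 1 : ℕ) : ℝ) ^ 6)⁻¹ * ((MD163 4 * periodConst (kappa163 4) 3) * Real.exp (kappa163 4 / 4)) * Real.exp (kappa163 4 / 16))) * κ₂)
            * (2 * (1 + 2 * (4 : ℕ) * 3 ^ ((4 : ℕ) - 1) * (((4 : ℕ) - 1 - (a₁ + a₂)).factorial * (8 / min (kappa163 4 / 16) (2 * δ)) ^ ((4 : ℕ) - 1 - (a₁ + a₂)) * (1 + 8 / min (kappa163 4 / 16) (2 * δ)))))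
            * (((m + 1 : ℕ) : ℝ)) ^ (2 * 4 - (a₁ + a₂)))
          * (1 + 2 * (4 : ℕ) * 3 ^ ((4 : ℕ) - 1) * (((4 : ℕ) - 1).factorial * (4 / min (kappa163 4 / 16) (2 * δ)) ^ ((4 : ℕ) - 1) * (1 + 4 / min (kappa163 4 / 16) (2 * δ))))))
      (min (kappa163 4 / 16) (2 * δ) / 2 / (4 : ℕ)) := by
  have hn : 1 ≤ m + 1 := Nat.le_add_left 1 m
  have hσ : 0 < kappa163 4 / 16 := by have := kappa163_pos 4; positivity
  set c : ℝ := (((m + 1 : ℕ) : ℝ)) ^ 2 with hc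
  -- the vertex families as packed currents (F1 §2)
  have hV : ∀ (ρ : Fin 4) (y : Site 4), (fun κ u => c • vertexRedF (m + 1) (fun κ u => ghCur κ u) κ u) ρ y
      = PackedCoframeSiteWords.gW (fun κ u => c * wH (N := m + 1) (d := 3) κ ρ (u - ((m + 1 : ℕ) : ℤ) • y)) := fun ρ y =>
    smul_vertexRedF_ghCur_eq_gW (m + 1) c ρ y
  -- F1's majorants for both legs, with F4's weight letters
  have hA : ∀ (y x z : Site 4) (g f : Unit), |comp L₁ ((fun κ u => c • vertexRedF (m + 1) (fun κ u => ghCur κ u) κ u) μ y) x z g f|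
      ≤ (4 * (1 + 2 ^ a₁' * Real.exp δ) * (|c| * ((((m + 1 : ℕ) : ℝ) ^ 5)⁻¹ * (MG163 4 * periodConst (kappa163 4) 3) * Real.exp (kappa163 4 / 4))) * κ₁' / nrm (x - z) ^ a₁'
          + 4 * 2 ^ a₁ * Real.exp δ * (|c| * ((((m + 1 : ℕ) : ℝ) ^ 6)⁻¹ * ((MD163 4 * periodConst (kappa163 4) 3) * Real.exp (kappa163 4 / 4)) * Real.exp (kappa163 4 / 16))) * κ₁ / nrm (x - z) ^ a₁)
        * Real.exp (-(δ / ((m + 1 : ℕ) : ℝ)) * supNorm (x - z)) * Real.exp (-(kappa163 4 / 16 / ((m + 1 : ℕ) : ℝ)) * supNorm (z - ((m + 1 : ℕ) : ℤ) • y)) := by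
    intro y x z g f
    rw [hV μ y]
    exact abs_comp_gW_le hn hκ₁ hκ₁' hδ.le hL₁ hdL₁ (fun κ z => abs_ghostWeight_le m c μ y κ z) (fun κ z => abs_ghostWeight_sub_le m c μ y κ z) x z g f
  have hB : ∀ (y z x : Site 4) (f g : Unit), |comp L₂ ((fun κ u => c • vertexRedF (m + 1) (fun κ u => ghCur κ u) κ u) ν y) z x f g|
      ≤ (4 * (1 + 2 ^ a₂' * Real.exp δ) * (|c| * ((((m + 1 : ℕ) : ℝ) ^ 5)⁻¹ * (MG163 4 * periodConst (kappa163 4) 3) * Real.exp (kappa163 4 / 4))) * κ₂' / nrm (z - x) ^ a₂'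
          + 4 * 2 ^ a₂ * Real.exp δ * (|c| * ((((m + 1 : ℕ) : ℝ) ^ 6)⁻¹ * ((MD163 4 * periodConst (kappa163 4) 3) * Real.exp (kappa163 4 / 4)) * Real.exp (kappa163 4 / 16))) * κ₂ / nrm (z - x) ^ a₂)
        * Real.exp (-(δ / ((m + 1 : ℕ) : ℝ)) * supNorm (z - x)) * Real.exp (-(kappa163 4 / 16 / ((m + 1 : ℕ) : ℝ)) * supNorm (x - ((m + 1 : ℕ) : ℤ) • y)) := by
    intro y z x f g
    rw [hV ν y]
    exact abs_comp_gW_le hn hκ₂ hκ₂' hδ.le hL₂ hdL₂ (fun κ z => abs_ghostWeight_le m c ν y κ z) (fun κ z => abs_ghostWeight_sub_le m c ν y κ z) z x f g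
  have hK5 : 0 ≤ |c| * ((((m + 1 : ℕ) : ℝ) ^ 5)⁻¹ * (MG163 4 * periodConst (kappa163 4) 3) * Real.exp (kappa163 4 / 4)) :=
    (mul_nonneg_iff_of_pos_right (Real.exp_pos _)).1 ((abs_nonneg _).trans (abs_ghostWeight_le m c μ 0 0 0))
  have hK6 : 0 ≤ |c| * ((((m + 1 : ℕ) : ℝ) ^ 6)⁻¹ * ((MD163 4 * periodConst (kappa163 4) 3) * Real.exp (kappa163 4 / 4)) * Real.exp (kappa163 4 / 16)) :=
    (mul_nonneg_iff_of_pos_right (Real.exp_pos _)).1 ((abs_nonneg _).trans (abs_ghostWeight_sub_le m c μ 0 0 0))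
  have h := decay510_biBubble_of_twoTerm (D := 4) (F := Unit) (by norm_num) hn (L₁ := L₁) (L₂ := L₂)
    (𝒱 := fun κ u => c • vertexRedF (m + 1) (fun κ u => ghCur κ u) κ u) (𝒱' := fun κ u => c • vertexRedF (m + 1) (fun κ u => ghCur κ u) κ u) μ ν
    (by positivity) (by positivity) (by positivity) (by positivity) hδ hσ
    (by omega) (by omega) (by omega) (by omega) hA hB
  simpa only [hc] using h

end Bubble

/-! ## §2 The tadpole at the road's ghost pair table -/

/-- [folklore] **THE ROAD TADPOLE LETTER**: a leg with `|L x y| ≤ S` against the road's ghost pair table (range `1`, two-centre density `n²·8K₅²e^{κ₄∕8}`)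
gives `Decay510 (z ↦ tadpole L (𝒲 μ 0 ν z)) (|Unit|²·(S·3⁴·A₂·K″(σ)·n⁴)) (σ∕2∕4)`, `σ = κ₄∕16`. -/
theorem decay510_road_tadpole (m : ℕ) {L : MKer 4 Unit} {S : ℝ} (hS : 0 ≤ S) (hL : ∀ x y (g f : Unit), |L x y g f| ≤ S) (μ ν : Fin 4) :
    Decay510 (fun z => tadpole L ((fun κ u l u' => (((m + 1 : ℕ) : ℝ) ^ 2) • tableRedF (m + 1)
        (fun κ u l u' => if u = u' ∧ κ = l then gh₂ κ u else (0 : MKer 4 Unit)) κ u l u') μ 0 ν z))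
      ((Fintype.card Unit : ℝ) ^ 2 * (S * (2 * (1 : ℕ) + 1) ^ 4
        * (|(((m + 1 : ℕ) : ℝ)) ^ 2| * (8 * ((((m + 1 : ℕ) : ℝ) ^ 5)⁻¹ * (MG163 4 * periodConst (kappa163 4) 3) * Real.exp (kappa163 4 / 4)) ^ 2 * Real.exp (kappa163 4 / 8)))
        * (1 + 2 * (4 : ℕ) * 3 ^ ((4 : ℕ) - 1) * (((4 : ℕ) - 1).factorial * (4 / (kappa163 4 / 16)) ^ ((4 : ℕ) - 1) * (1 + 4 / (kappa163 4 / 16)))) * (((m + 1 : ℕ) : ℝ)) ^ 4))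
      (kappa163 4 / 16 / 2 / (4 : ℕ)) := by
  have hn : 1 ≤ m + 1 := Nat.le_add_left 1 m
  have hσ : 0 < kappa163 4 / 16 := by have := kappa163_pos 4; positivity
  set c : ℝ := (((m + 1 : ℕ) : ℝ)) ^ 2 with hc
  have hA₂ : 0 ≤ |c| * (8 * ((((m + 1 : ℕ) : ℝ) ^ 5)⁻¹ * (MG163 4 * periodConst (kappa163 4) 3) * Real.exp (kappa163 4 / 4)) ^ 2 * Real.exp (kappa163 4 / 8)) := by
    positivity
  have h := decay510_tadpole_of_sup_range (D := 4) (F := Unit) (by norm_num) hn (L := L)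
    (𝒲 := fun κ u l u' => c • tableRedF (m + 1) (fun κ u l u' => if u = u' ∧ κ = l then gh₂ κ u else (0 : MKer 4 Unit)) κ u l u')
    μ ν (r := 1) hS hA₂ hσ hL
    (fun y' y x f g => abs_ghostTable_le m c μ 0 ν y' y x f g)
    (fun y' y x f g hfar => ghostTable_eq_zero_of_far (m + 1) c μ 0 ν y' y x f g hfar)
  simpa only [hc] using h

end Summit.QuantumFields.BalabanUV.Beta.D1BFx.GhostRoadWordLetters

end
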